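import Literature.NumberTheory.LFunctions.SelbergClassStrongMultiplicityOneProofs
import Mathlib.NumberTheory.LSeries.Deriv
import Mathlib.NumberTheory.LSeries.Convolution
import Mathlib.Analysis.Real.Pi.Bounds
import HarnessLib

/-!
# The Selberg class: the Euler-product exponent series and its coefficients on prime powers

Sibling proofs file of `SelbergClass.lean` / `SelbergClassStrongMultiplicityOne.lean` (layer 2 of
the formalisation of Soundararajan, *Strong multiplicity one for the Selberg class*,
arXiv:math/0210299 — the facts about the coefficients `b_F(n)` of `log F` that the printed proof
uses on p. 1: "`a_F(p) = a_G(p)` (equivalently `b_F(p) = b_G(p)`)" and "from the assumption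
`a_F(n) ≪_ε n^ε` it follows that `b_F(p^k) ≪_{k,ε} p^ε`"). Pure proof file: theorems only.

The Euler product axiom (v) of a `SelbergDatum` `D` provides *some* `b : ℕ → ℂ` and `θ < 1/2` with
`b` supported on prime powers, `b(n) ≪ n^θ` and `exp (∑ b(n) n^{-s}) = F(s)` on `re s > 1` (in
Mathlib's pointwise `LSeries` convention). All statements below take these three properties of a
pair `(b, θ)` as hypotheses `hb`, `hO`, `hexp`, so that they apply after
`obtain ⟨b, θ, hθ, hb, hO, hexp⟩ := D.euler_product`.

## Main results (all proved)

* `SelbergDatum.LSeriesSummable_euler` — `∑ b(n) n^{-s}` converges absolutely for `re s > 1`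
  (so the junk-value convention of `LSeries` never fires there); `abscissaOfAbsConv_euler_le_one`.
* `SelbergDatum.LSeries_logMul_coeff_eq` — logarithmic differentiation:
  `∑ a(n) log n n^{-s} = F(s) · ∑ b(n) log n n^{-s}` on `re s > 1`.
* `SelbergDatum.logMul_coeff_eq_sum` — coefficientwise: `a(n) log n = ∑_{de=n} a(d) b(e) log e`.
* `SelbergDatum.natCast_mul_coeff_prime_pow_eq_sum` — on prime powers:
  `k a(p^k) = ∑_{j ≤ k} j b(p^j) a(p^{k-j})`.
* `SelbergDatum.euler_coeff_prime`, `SelbergDatum.euler_coeff_prime_sq` — `b(p) = a(p)`,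
  `b(p²) = a(p²) − a(p)²/2`.
* `SelbergDatum.exists_norm_coeff_le` — Ramanujan at every `n ≥ 1`: `‖a(n)‖ ≤ C_ε n^ε`.
* `SelbergDatum.exists_norm_euler_prime_pow_le` — `‖b(p^k)‖ ≤ B_{K,ε} p^{kε}` for `k ≤ K`.

## References

* K. Soundararajan, *Strong multiplicity one for the Selberg class*, Canad. Math. Bull. 47 (2004)
  468–474; arXiv:math/0210299, p. 1. [Soundararajan2002]
* A. Selberg, *Old and new conjectures and results about a class of Dirichlet series* (1992), §1,
  axioms (i), (v) and the remark following them. [Selberg1992]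
-/

noncomputable section

open Complex Filter Topology Set Asymptotics LSeries
open scoped LSeries.notation

namespace Literature.NumberTheory.LFunctions

namespace SelbergDatum

variable (D : SelbergDatum)

/-- `exp z = 1` with `‖z‖ < 1` forces `z = 0` (the non-zero periods `2πik` have norm `≥ 2π`).
[folklore] -/
theorem eq_zero_of_exp_eq_one_of_norm_lt_one {z : ℂ} (hz : cexp z = 1) (hn : ‖z‖ < 1) : z = 0 := by
  obtain ⟨k, rfl⟩ := Complex.exp_eq_one_iff.mp hz
  rcases eq_or_ne k 0 with rfl | hk
  · simp
  · exfalso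
    have h1 : (1 : ℝ) ≤ |(k : ℝ)| := by
      rw [← Int.cast_abs]; exact_mod_cast Int.one_le_abs hk
    have : ‖(k : ℂ) * (2 * Real.pi * I)‖ = |(k : ℝ)| * (2 * Real.pi) := by
      rw [norm_mul, Complex.norm_intCast]
      simp [abs_of_pos Real.pi_pos]
    rw [this] at hn
    nlinarith [Real.pi_gt_three, Real.pi_pos]

/-- **The Euler-product exponent series converges absolutely on `re s > 1`.** If `b` is supported
on prime powers, `b(n) ≪ n^θ`, and `exp (∑ b(n) n^{-s}) = F(s)` for `re s > 1` (axiom (v), in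
the pointwise convention of `SelbergClass.lean`), then `∑ b(n) n^{-s}` is (absolutely) summable for
every `re s > 1`. (If it diverged at some `s₀`, it would diverge on the strip
`1 < re s < re s₀`, where Mathlib's `LSeries` then vanishes, forcing `F = 1` on `re s > 1` by
analytic continuation; then `exp (∑ b(n) n^{-x}) = 1` for large real `x` while the sum tends to
`b(1) = 0`, so `b = 0`, which converges everywhere.) [folklore] -/
theorem LSeriesSummable_euler {b : ℕ → ℂ} {θ : ℝ}
    (hb : ∀ n, ¬ IsPrimePow n → b n = 0) (hO : b =O[atTop] fun n ↦ (n : ℝ) ^ θ)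
    (hexp : ∀ s : ℂ, 1 < s.re → cexp (LSeries b s) = D.toFun s)
    {s : ℂ} (hs : 1 < s.re) : LSeriesSummable b s := by
  by_contra hns
  -- abscissa of `b` is finite
  have hbabs : abscissaOfAbsConv b ≤ (θ + 1 : ℝ) :=
    abscissaOfAbsConv_le_of_forall_lt_LSeriesSummable fun y hy ↦
      LSeriesSummable_of_isBigO_rpow (s := (y : ℂ)) (x := θ + 1) (by simpa using hy)
        (by simpa only [add_sub_cancel_right] using hO)
  -- `F = 1` on the strip `1 < re z < re s`
  have hstrip : ∀ z : ℂ, 1 < z.re → z.re < s.re → D.toFun z = 1 := by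
    intro z hz1 hz2
    have hnz : ¬ LSeriesSummable b z := fun h ↦ hns (h.of_re_le_re hz2.le)
    rw [← hexp z hz1, LSeries, tsum_eq_zero_of_not_summable hnz, Complex.exp_zero]
  -- hence `LSeries a = 1` on `re z > 1` (identity theorem)
  have ha1 : ∀ z : ℂ, 1 < z.re → LSeries D.coeff z = 1 := by
    have han : AnalyticOnNhd ℂ (LSeries D.coeff) {z : ℂ | 1 < z.re} := by
      refine (LSeries_analyticOnNhd D.coeff).mono fun z hz ↦ ?_
      exact lt_of_le_of_lt (abscissaOfAbsConv_le_of_forall_lt_LSeriesSummable fun y hy ↦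
        D.LSeriesSummable_coeff y (by simpa using hy)) (by exact_mod_cast hz)
    have hpre : IsPreconnected {z : ℂ | 1 < z.re} :=
      (convex_halfSpace_re_gt (1 : ℝ)).isPreconnected
    -- a point of the strip
    set z₀ : ℂ := (((1 + s.re) / 2 : ℝ) : ℂ) with hz₀
    have hz₀1 : 1 < z₀.re := by simp [hz₀]; linarith
    have hz₀2 : z₀.re < s.re := by simp [hz₀]; linarith
    have hev : LSeries D.coeff =ᶠ[𝓝 z₀] fun _ ↦ (1 : ℂ) := by
      have hopen : IsOpen {z : ℂ | 1 < z.re ∧ z.re < s.re} :=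
        (isOpen_lt continuous_const continuous_re).inter (isOpen_lt continuous_re continuous_const)
      filter_upwards [hopen.mem_nhds (show z₀ ∈ {z : ℂ | 1 < z.re ∧ z.re < s.re} from ⟨hz₀1, hz₀2⟩)]
        with z hz
      rw [← D.eqOn_LSeries hz.1]
      exact hstrip z hz.1 hz.2
    intro z hz
    exact han.eqOn_of_preconnected_of_eventuallyEq analyticOnNhd_const hpre hz₀1 hev hz
  -- so `exp (LSeries b x) = 1` for real `x > 1`
  have hexp1 : ∀ x : ℝ, 1 < x → cexp (LSeries b x) = 1 := by
    intro x hx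
    have hx' : 1 < (x : ℂ).re := by simpa using hx
    rw [hexp x hx', D.eqOn_LSeries hx', ha1 x hx']
  -- `LSeries b x → b 1 = 0`
  have hb1 : b 1 = 0 := hb 1 not_isPrimePow_one
  have hb0 : b 0 = 0 := hb 0 not_isPrimePow_zero
  have htend : Tendsto (fun x : ℝ ↦ LSeries b x) atTop (𝓝 0) := by
    have := LSeries.tendsto_cpow_mul_atTop (f := b) (n := 0) (fun m hm ↦ by
      rw [Nat.le_zero.mp hm]; exact hb0) (hbabs.trans_lt (EReal.coe_lt_top _))
    simpa [hb1] using this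
  -- hence `LSeries b x = 0` for large `x`
  have hzero : (fun x : ℝ ↦ LSeries b x) =ᶠ[atTop] (0 : ℝ → ℂ) := by
    have h1 : ∀ᶠ x : ℝ in atTop, ‖LSeries b x‖ < 1 := by
      have hn : Tendsto (fun x : ℝ ↦ ‖LSeries b x‖) atTop (𝓝 0) := by
        simpa using htend.norm
      exact (tendsto_order.1 hn).2 1 zero_lt_one
    filter_upwards [h1, eventually_gt_atTop 1] with x hx hx1
    exact eq_zero_of_exp_eq_one_of_norm_lt_one (hexp1 x hx1) hx
  -- so `b = 0`
  have hbz : b = 0 := by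
    rcases LSeries_eventually_eq_zero_iff'.mp hzero with h | h
    · funext n
      rcases eq_or_ne n 0 with rfl | hn
      · exact hb0
      · exact h n hn
    · exact absurd h (hbabs.trans_lt (EReal.coe_lt_top _)).ne
  exact hns (hbz ▸ (LSeriesSummable_zero (s := s)))


/-- The abscissa of absolute convergence of the Euler exponent series `∑ b(n) n^{-s}` is `≤ 1`
(`LSeriesSummable_euler`). [folklore] -/
theorem abscissaOfAbsConv_euler_le_one {b : ℕ → ℂ} {θ : ℝ}
    (hb : ∀ n, ¬ IsPrimePow n → b n = 0) (hO : b =O[atTop] fun n ↦ (n : ℝ) ^ θ)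
    (hexp : ∀ s : ℂ, 1 < s.re → cexp (LSeries b s) = D.toFun s) :
    abscissaOfAbsConv b ≤ 1 :=
  abscissaOfAbsConv_le_of_forall_lt_LSeriesSummable fun y hy ↦
    D.LSeriesSummable_euler hb hO hexp (by simpa using hy)

/-- **Logarithmic differentiation of the Euler product**: on `re s > 1`,
`∑ a(n) log n · n^{-s} = (∑ a(n) n^{-s}) · (∑ b(n) log n · n^{-s})`, i.e. `-F' = F · (-(log F)')`,
obtained by differentiating `F = exp (∑ b(n) n^{-s})` (axiom (v)) and `F = ∑ a(n) n^{-s}` (axiom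
(i)) on the open half-plane. [folklore] -/
theorem LSeries_logMul_coeff_eq {b : ℕ → ℂ} {θ : ℝ}
    (hb : ∀ n, ¬ IsPrimePow n → b n = 0) (hO : b =O[atTop] fun n ↦ (n : ℝ) ^ θ)
    (hexp : ∀ s : ℂ, 1 < s.re → cexp (LSeries b s) = D.toFun s) {s : ℂ} (hs : 1 < s.re) :
    LSeries (logMul D.coeff) s = LSeries D.coeff s * LSeries (logMul b) s := by
  have hopen : IsOpen {z : ℂ | 1 < z.re} := isOpen_lt continuous_const continuous_re
  have hab : abscissaOfAbsConv b < s.re :=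
    (D.abscissaOfAbsConv_euler_le_one hb hO hexp).trans_lt (by exact_mod_cast hs)
  have haa : abscissaOfAbsConv D.coeff < s.re :=
    D.abscissaOfAbsConv_coeff_le_one.trans_lt (by exact_mod_cast hs)
  -- the two expressions of `F` agree near `s`
  have hev : LSeries D.coeff =ᶠ[𝓝 s] fun z ↦ cexp (LSeries b z) := by
    filter_upwards [hopen.mem_nhds hs] with z hz
    rw [← D.eqOn_LSeries hz, hexp z hz]
  have h1 : deriv (LSeries D.coeff) s = -LSeries (logMul D.coeff) s := LSeries_deriv haa
  have h2 : deriv (fun z ↦ cexp (LSeries b z)) s =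
      cexp (LSeries b s) * (-LSeries (logMul b) s) :=
    ((LSeries_hasDerivAt hab).cexp).deriv
  rw [hev.deriv_eq, h2, hexp s hs] at h1
  rw [← D.eqOn_LSeries hs]
  linear_combination h1


/-- **Coefficientwise form of `-F' = F · (-(log F)')`**: for every `n ≥ 1`,
`a(n) log n = ∑_{de = n} a(d) b(e) log e` (uniqueness of Dirichlet coefficients applied to
`LSeries_logMul_coeff_eq`). [folklore] -/
theorem logMul_coeff_eq_sum {b : ℕ → ℂ} {θ : ℝ}
    (hb : ∀ n, ¬ IsPrimePow n → b n = 0) (hO : b =O[atTop] fun n ↦ (n : ℝ) ^ θ)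
    (hexp : ∀ s : ℂ, 1 < s.re → cexp (LSeries b s) = D.toFun s) {n : ℕ} (hn : n ≠ 0) :
    Complex.log n * D.coeff n =
      ∑ q ∈ n.divisorsAntidiagonal, D.coeff q.1 * (Complex.log q.2 * b q.2) := by
  have hb1 : abscissaOfAbsConv b ≤ 1 := D.abscissaOfAbsConv_euler_le_one hb hO hexp
  have ha1 : abscissaOfAbsConv D.coeff ≤ 1 := D.abscissaOfAbsConv_coeff_le_one
  have key : logMul D.coeff n = (D.coeff ⍟ logMul b) n := by
    refine LSeries.eq_of_LSeries_eventually_eq (f := logMul D.coeff) (g := D.coeff ⍟ logMul b)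
      ?_ ?_ ?_ hn
    · rw [abscissaOfAbsConv_logMul]
      exact ha1.trans_lt (EReal.coe_lt_top 1)
    · refine (abscissaOfAbsConv_convolution_le _ _).trans_lt (max_lt ?_ ?_)
      · exact ha1.trans_lt (EReal.coe_lt_top 1)
      · rw [abscissaOfAbsConv_logMul]
        exact hb1.trans_lt (EReal.coe_lt_top 1)
    · filter_upwards [eventually_gt_atTop 1] with x hx
      have hx' : 1 < (x : ℂ).re := by simpa using hx
      have hbx : abscissaOfAbsConv b < (x : ℂ).re := hb1.trans_lt (by exact_mod_cast hx')
      rw [LSeries_convolution' (D.LSeriesSummable_coeff x hx') (LSeriesSummable_logMul_of_lt_re hbx)]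
      exact D.LSeries_logMul_coeff_eq hb hO hexp hx'
  simpa [convolution_def, logMul] using key

/-- **The recursion on prime powers**: for a prime `p` and `k ≥ 0`,
`k · a(p^k) = ∑_{j ≤ k} j · b(p^j) · a(p^{k-j})` (the previous identity at `n = p^k`, divided by
`log p`). [folklore] -/
theorem natCast_mul_coeff_prime_pow_eq_sum {b : ℕ → ℂ} {θ : ℝ}
    (hb : ∀ n, ¬ IsPrimePow n → b n = 0) (hO : b =O[atTop] fun n ↦ (n : ℝ) ^ θ)
    (hexp : ∀ s : ℂ, 1 < s.re → cexp (LSeries b s) = D.toFun s) {p : ℕ} (hp : p.Prime) (k : ℕ) :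
    (k : ℂ) * D.coeff (p ^ k) =
      ∑ j ∈ Finset.range (k + 1), (j : ℂ) * b (p ^ j) * D.coeff (p ^ (k - j)) := by
  have hlogp : Complex.log p ≠ 0 := by
    rw [← natCast_log, Complex.ofReal_ne_zero]
    exact (Real.log_pos (by exact_mod_cast hp.one_lt)).ne'
  have hlogpow : ∀ m : ℕ, Complex.log ((p ^ m : ℕ) : ℂ) = (m : ℂ) * Complex.log p := by
    intro m
    rw [← natCast_log, ← natCast_log, Nat.cast_pow, Real.log_pow]
    push_cast
    ring
  have key := D.logMul_coeff_eq_sum hb hO hexp (n := p ^ k) (pow_ne_zero k hp.ne_zero)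
  rw [Nat.sum_divisorsAntidiagonal' (fun d e ↦ D.coeff d * (Complex.log e * b e)),
    Nat.sum_divisors_prime_pow hp] at key
  -- rewrite `p^k / p^j = p^(k-j)` and the logarithms
  have key' : (k : ℂ) * Complex.log p * D.coeff (p ^ k) =
      ∑ j ∈ Finset.range (k + 1), (j : ℂ) * Complex.log p * b (p ^ j) * D.coeff (p ^ (k - j)) := by
    rw [hlogpow] at key
    rw [key]
    refine Finset.sum_congr rfl fun j hj ↦ ?_
    have hjk : j ≤ k := Nat.lt_succ_iff.mp (Finset.mem_range.mp hj)
    rw [Nat.pow_div hjk hp.pos, hlogpow]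
    ring
  have := key'
  apply mul_left_cancel₀ hlogp
  rw [show Complex.log p * ((k : ℂ) * D.coeff (p ^ k)) = (k : ℂ) * Complex.log p * D.coeff (p ^ k)
    by ring, this, Finset.mul_sum]
  refine Finset.sum_congr rfl fun j _ ↦ by ring

/-- `b(p) = a(p)` at every prime (the case `k = 1` of the recursion, with `a(1) = 1`).
[folklore] -/
theorem euler_coeff_prime {b : ℕ → ℂ} {θ : ℝ}
    (hb : ∀ n, ¬ IsPrimePow n → b n = 0) (hO : b =O[atTop] fun n ↦ (n : ℝ) ^ θ)
    (hexp : ∀ s : ℂ, 1 < s.re → cexp (LSeries b s) = D.toFun s) {p : ℕ} (hp : p.Prime) :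
    b p = D.coeff p := by
  have := D.natCast_mul_coeff_prime_pow_eq_sum hb hO hexp hp 1
  simp [Finset.sum_range_succ, D.coeff_one] at this
  exact this.symm

/-- `b(p²) = a(p²) - a(p)²/2` at every prime (the case `k = 2` of the recursion).
[folklore] -/
theorem euler_coeff_prime_sq {b : ℕ → ℂ} {θ : ℝ}
    (hb : ∀ n, ¬ IsPrimePow n → b n = 0) (hO : b =O[atTop] fun n ↦ (n : ℝ) ^ θ)
    (hexp : ∀ s : ℂ, 1 < s.re → cexp (LSeries b s) = D.toFun s) {p : ℕ} (hp : p.Prime) :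
    b (p ^ 2) = D.coeff (p ^ 2) - D.coeff p ^ 2 / 2 := by
  have h2 := D.natCast_mul_coeff_prime_pow_eq_sum hb hO hexp hp 2
  have h1 := D.euler_coeff_prime hb hO hexp hp
  simp [Finset.sum_range_succ, D.coeff_one] at h2
  rw [h1] at h2
  linear_combination (-1 / 2 : ℂ) * h2


/-- From `f(n) ≪ n^e` (`e ≥ 0`) to a bound valid at every `n ≥ 1`: `‖f(n)‖ ≤ C n^e` with one
constant `C > 0` (the finitely many small `n` are absorbed since `n^e ≥ 1`). [folklore] -/
theorem exists_norm_le_mul_rpow_of_isBigO {f : ℕ → ℂ} {e : ℝ} (he : 0 ≤ e)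
    (h : f =O[atTop] fun n ↦ (n : ℝ) ^ e) :
    ∃ C : ℝ, 0 < C ∧ ∀ n : ℕ, 1 ≤ n → ‖f n‖ ≤ C * (n : ℝ) ^ e := by
  obtain ⟨C, hC⟩ := h.bound
  obtain ⟨N, hN⟩ := eventually_atTop.mp hC
  refine ⟨max C 0 + ∑ n ∈ Finset.range N, ‖f n‖ + 1, by positivity, fun n hn ↦ ?_⟩
  have hn1 : (1 : ℝ) ≤ (n : ℝ) ^ e := Real.one_le_rpow (by exact_mod_cast hn) he
  have hsum : 0 ≤ ∑ n ∈ Finset.range N, ‖f n‖ := Finset.sum_nonneg fun _ _ ↦ norm_nonneg _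
  rcases lt_or_ge n N with hlt | hge
  · have hmem : ‖f n‖ ≤ ∑ k ∈ Finset.range N, ‖f k‖ :=
      Finset.single_le_sum (f := fun k ↦ ‖f k‖) (fun _ _ ↦ norm_nonneg _)
        (Finset.mem_range.mpr hlt)
    calc ‖f n‖ ≤ ∑ k ∈ Finset.range N, ‖f k‖ := hmem
      _ ≤ (max C 0 + ∑ k ∈ Finset.range N, ‖f k‖ + 1) * 1 := by
          rw [mul_one]; linarith [le_max_right C 0]
      _ ≤ (max C 0 + ∑ k ∈ Finset.range N, ‖f k‖ + 1) * (n : ℝ) ^ e :=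
          mul_le_mul_of_nonneg_left hn1 (by positivity)
  · have h1 := hN n hge
    rw [Real.norm_of_nonneg (Real.rpow_nonneg (Nat.cast_nonneg n) e)] at h1
    calc ‖f n‖ ≤ C * (n : ℝ) ^ e := h1
      _ ≤ (max C 0 + ∑ k ∈ Finset.range N, ‖f k‖ + 1) * (n : ℝ) ^ e := by
          apply mul_le_mul_of_nonneg_right _ (by positivity)
          linarith [le_max_left C 0]

/-- The Ramanujan axiom at every `n ≥ 1`: `‖a(n)‖ ≤ C_ε n^ε`. [folklore] -/
theorem exists_norm_coeff_le (ε : ℝ) (hε : 0 < ε) :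
    ∃ C : ℝ, 0 < C ∧ ∀ n : ℕ, 1 ≤ n → ‖D.coeff n‖ ≤ C * (n : ℝ) ^ ε :=
  exists_norm_le_mul_rpow_of_isBigO hε.le (D.ramanujan ε hε)

/-- **`b(p^k) ≪_{k,ε} p^{kε}`** (Soundararajan, p. 1: "from the assumption `a_F(n) ≪_ε n^ε` it
follows that `b_F(p^k) ≪_{k,ε} p^ε`"): for every `ε > 0` and `K` there is `B` with
`‖b(p^k)‖ ≤ B · p^{kε}` for all primes `p` and all `k ≤ K`, by induction on `k` from the
recursion `k a(p^k) = ∑_{j ≤ k} j b(p^j) a(p^{k-j})` and the Ramanujan bound.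
[cite: Soundararajan2002, p. 1] -/
theorem exists_norm_euler_prime_pow_le {b : ℕ → ℂ} {θ : ℝ}
    (hb : ∀ n, ¬ IsPrimePow n → b n = 0) (hO : b =O[atTop] fun n ↦ (n : ℝ) ^ θ)
    (hexp : ∀ s : ℂ, 1 < s.re → cexp (LSeries b s) = D.toFun s) {ε : ℝ} (hε : 0 < ε) (K : ℕ) :
    ∃ B : ℝ, 0 < B ∧ ∀ p : ℕ, p.Prime → ∀ k ≤ K, ‖b (p ^ k)‖ ≤ B * (p : ℝ) ^ ((k : ℝ) * ε) := by
  obtain ⟨C, hC, hCa⟩ := D.exists_norm_coeff_le ε hε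
  induction K with
  | zero =>
    refine ⟨1, one_pos, fun p hp k hk ↦ ?_⟩
    rw [Nat.le_zero.mp hk, pow_zero, hb 1 not_isPrimePow_one]
    simp
  | succ K ih =>
    obtain ⟨B, hB, hBb⟩ := ih
    -- the new constant
    refine ⟨max B (C + C * (K + 1) * B), lt_max_of_lt_left hB, fun p hp k hk ↦ ?_⟩
    have hp0 : (0 : ℝ) < p := by exact_mod_cast hp.pos
    have hp1 : (1 : ℝ) ≤ p := by exact_mod_cast hp.one_lt.le
    rcases Nat.lt_succ_iff_lt_or_eq.mp (Nat.lt_succ_iff.mpr hk) with hlt | rfl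
    · exact (hBb p hp k (Nat.lt_succ_iff.mp hlt)).trans
        (mul_le_mul_of_nonneg_right (le_max_left _ _) (by positivity))
    · -- the case `k = K + 1`: isolate the top term of the recursion
      have hrec := D.natCast_mul_coeff_prime_pow_eq_sum hb hO hexp hp (K + 1)
      rw [Finset.sum_range_succ, Nat.sub_self, pow_zero, D.coeff_one, mul_one] at hrec
      -- `(K+1) b(p^{K+1}) = (K+1) a(p^{K+1}) - ∑_{j ≤ K} j b(p^j) a(p^{K+1-j})`
      have hK1 : ((K + 1 : ℕ) : ℂ) ≠ 0 := by exact_mod_cast Nat.succ_ne_zero K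
      have hbK : b (p ^ (K + 1)) = D.coeff (p ^ (K + 1)) -
          (∑ j ∈ Finset.range (K + 1), (j : ℂ) * b (p ^ j) * D.coeff (p ^ (K + 1 - j))) /
            ((K + 1 : ℕ) : ℂ) := by
        field_simp
        linear_combination -hrec
      -- bound each term of the sum
      have hterm : ∀ j ∈ Finset.range (K + 1),
          ‖(j : ℂ) * b (p ^ j) * D.coeff (p ^ (K + 1 - j))‖ ≤
            (K + 1) * (B * C) * (p : ℝ) ^ (((K + 1 : ℕ) : ℝ) * ε) := by
        intro j hj
        have hjK : j ≤ K := Nat.lt_succ_iff.mp (Finset.mem_range.mp hj)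
        have h1 := hBb p hp j hjK
        have h2 := hCa (p ^ (K + 1 - j)) (Nat.one_le_pow _ _ hp.pos)
        rw [norm_mul, norm_mul, Complex.norm_natCast]
        have hj' : (j : ℝ) ≤ K + 1 := by exact_mod_cast hjK.trans (Nat.le_succ K)
        have hpow : (p : ℝ) ^ ((j : ℝ) * ε) * (((p ^ (K + 1 - j) : ℕ) : ℝ) ^ ε) =
            (p : ℝ) ^ (((K + 1 : ℕ) : ℝ) * ε) := by
          rw [Nat.cast_pow, ← Real.rpow_natCast, ← Real.rpow_mul hp0.le, ← Real.rpow_add hp0]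
          congr 1
          push_cast [Nat.cast_sub (hjK.trans (Nat.le_succ K))]
          ring
        calc (j : ℝ) * ‖b (p ^ j)‖ * ‖D.coeff (p ^ (K + 1 - j))‖
            ≤ (K + 1) * (B * (p : ℝ) ^ ((j : ℝ) * ε)) * (C * (((p ^ (K + 1 - j) : ℕ) : ℝ) ^ ε)) := by
              gcongr
          _ = (K + 1) * (B * C) * ((p : ℝ) ^ ((j : ℝ) * ε) * (((p ^ (K + 1 - j) : ℕ) : ℝ) ^ ε)) := by
              ring
          _ = (K + 1) * (B * C) * (p : ℝ) ^ (((K + 1 : ℕ) : ℝ) * ε) := by rw [hpow]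
      have hsum : ‖∑ j ∈ Finset.range (K + 1), (j : ℂ) * b (p ^ j) * D.coeff (p ^ (K + 1 - j))‖ ≤
          (K + 1) * ((K + 1) * (B * C) * (p : ℝ) ^ (((K + 1 : ℕ) : ℝ) * ε)) := by
        refine (norm_sum_le _ _).trans ?_
        have := Finset.sum_le_sum hterm
        simpa using this
      have ha := hCa (p ^ (K + 1)) (Nat.one_le_pow _ _ hp.pos)
      rw [Nat.cast_pow, ← Real.rpow_natCast, ← Real.rpow_mul hp0.le] at ha
      rw [hbK]
      refine (norm_sub_le _ _).trans ?_
      rw [norm_div, Complex.norm_natCast]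
      have hK1r : (0 : ℝ) < ((K + 1 : ℕ) : ℝ) := by positivity
      calc ‖D.coeff (p ^ (K + 1))‖ +
            ‖∑ j ∈ Finset.range (K + 1), (j : ℂ) * b (p ^ j) * D.coeff (p ^ (K + 1 - j))‖ /
              ((K + 1 : ℕ) : ℝ)
          ≤ C * (p : ℝ) ^ (((K + 1 : ℕ) : ℝ) * ε) +
            (K + 1) * ((K + 1) * (B * C) * (p : ℝ) ^ (((K + 1 : ℕ) : ℝ) * ε)) /
              ((K + 1 : ℕ) : ℝ) := by
            gcongr
        _ = (C + C * (K + 1) * B) * (p : ℝ) ^ (((K + 1 : ℕ) : ℝ) * ε) := by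
            field_simp
            push_cast
            ring
        _ ≤ max B (C + C * (K + 1) * B) * (p : ℝ) ^ (((K + 1 : ℕ) : ℝ) * ε) :=
            mul_le_mul_of_nonneg_right (le_max_right _ _) (by positivity)

/-- **`F'(s) = F(s) · (log F)'(s)` on `re s > 1`**: the function of a Selberg datum is
differentiable at every `s` with `re s > 1`, with derivative `-F(s) · ∑ b(n) log n n^{-s}`
(axiom (v) and termwise differentiation of the absolutely convergent exponent series).
[folklore] -/
theorem hasDerivAt_toFun_euler {b : ℕ → ℂ} (hsum : ∀ s : ℂ, 1 < s.re → LSeriesSummable b s)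
    (hexp : ∀ s : ℂ, 1 < s.re → cexp (LSeries b s) = D.toFun s) {s : ℂ} (hs : 1 < s.re) :
    HasDerivAt D.toFun (-(D.toFun s * LSeries (logMul b) s)) s := by
  have hopen : IsOpen {z : ℂ | 1 < z.re} := isOpen_lt continuous_const continuous_re
  have hab : abscissaOfAbsConv b < s.re :=
    (abscissaOfAbsConv_le_of_forall_lt_LSeriesSummable fun y hy ↦
      hsum y (by simpa using hy)).trans_lt (by exact_mod_cast hs)
  have hev : (fun z ↦ cexp (LSeries b z)) =ᶠ[𝓝 s] D.toFun := by
    filter_upwards [hopen.mem_nhds hs] with z hz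
    exact hexp z hz
  have h := ((LSeries_hasDerivAt hab).cexp).congr_of_eventuallyEq hev.symm
  rw [hexp s hs] at h
  simpa only [mul_neg] using h

/-- **Euler-product bounds for `|F|` on `re s > 1`**: `e^{-M} ≤ |F(s)| ≤ e^{M}` with
`M = ∑ |b(n)| n^{-re s}` (from `F = exp (∑ b(n) n^{-s})`). [folklore] -/
theorem exp_neg_le_norm_toFun_euler {b : ℕ → ℂ} (hsum : ∀ s : ℂ, 1 < s.re → LSeriesSummable b s)
    (hexp : ∀ s : ℂ, 1 < s.re → cexp (LSeries b s) = D.toFun s) {s : ℂ} (hs : 1 < s.re) :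
    Real.exp (-(∑' n, ‖term b s n‖)) ≤ ‖D.toFun s‖ ∧
      ‖D.toFun s‖ ≤ Real.exp (∑' n, ‖term b s n‖) := by
  have hn : ‖LSeries b s‖ ≤ ∑' n, ‖term b s n‖ := norm_tsum_le_tsum_norm (hsum s hs).norm
  rw [← hexp s hs, Complex.norm_exp]
  constructor
  · apply Real.exp_le_exp.mpr
    have := (abs_le.mp ((Complex.abs_re_le_norm _).trans hn)).1
    linarith
  · exact Real.exp_le_exp.mpr ((Complex.re_le_norm _).trans hn)

/-- The bound `b(n) ≪ n^θ` at every `n ≥ 1`, with the exponent `max θ 0` (so that it is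
available as a pointwise inequality also when the datum's `θ` is negative). [folklore] -/
theorem exists_norm_euler_le {b : ℕ → ℂ} {θ : ℝ} (hO : b =O[atTop] fun n ↦ (n : ℝ) ^ θ) :
    ∃ C : ℝ, 0 < C ∧ ∀ n : ℕ, 1 ≤ n → ‖b n‖ ≤ C * (n : ℝ) ^ (max θ 0) := by
  refine exists_norm_le_mul_rpow_of_isBigO (le_max_right θ 0) (hO.trans ?_)
  refine (isBigO_of_le' (c := 1) _ fun n ↦ ?_)
  rcases Nat.eq_zero_or_pos n with rfl | hn
  · rcases eq_or_ne θ 0 with rfl | hθ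
    · simp
    · simp [Real.zero_rpow hθ]
  · rw [one_mul, Real.norm_of_nonneg (Real.rpow_nonneg (Nat.cast_nonneg n) _),
      Real.norm_of_nonneg (Real.rpow_nonneg (Nat.cast_nonneg n) _)]
    exact Real.rpow_le_rpow_of_exponent_le (by exact_mod_cast hn) (le_max_left θ 0)


end SelbergDatum
end Literature.NumberTheory.LFunctions

end
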